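import Mathlib
import HarnessLib
import HarnessLib.Audit
import Summits.AtomisticToContinuum.Statement
import Literature.MathematicalPhysics.QuantumManyBody.PeriodicBoseGas
import Literature.MathematicalPhysics.QuantumManyBody.PeriodicBoseGasJastrow
import HarnessLib.Audit.Status.Attr

/-!
Route: BECParentAnchor

# Route BECParentAnchor — Jastrow parent-Hamiltonian anchor — condensation reduced to one-particle
flatness of the pair-dressed corrector

X = ParentEnergyProximity ∧ FlatnessTransfer ∧ BoundaryTransferWeak ("it suffices to show X"; card
parent-hamiltonian-anchor made formal on the TORUS;
conforming re-filing of route BECParentHamiltonian (retired `not-a-thesis` 2026-08-15), REPAIRED at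
rev 3 after the route review rreview-0815T13-11
(Loophole.lean / CruxImpliedByTarget.lean, Lean-certified): the old rank-2 crux CorrectorFlatness
(stmt-9107) admitted the trivial profile φ ≡ 1 and
was implied by the target PeriodicBEC by Chebyshev, i.e. equivalent to it modulo the provable
supports — it is replaced by the ε-quantified,
interaction-PINNED PinnedCorrectorFlatness, and the formerly dangling ParentEnergyProximity is wired
into the deciding theorem through the new
transfer crux FlatnessTransfer : ParentEnergyProximity → PinnedCorrectorFlatness).
ANCHOR (card (A)): for a pair profile φ (IsPairProfile b φ: C¹, even, 0 ≤ φ ≤ 1, φ = 1 off B_b) the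
Jastrow state F = Π_{i<j}Φ(x_i−x_j) is the
zero-energy ground state of the parent Hamiltonian H_F = −Δ + ΔF/F, whose quadratic form is the
weighted Dirichlet form ∫F²|∇(Ψ/F)|² (ground-state
representation; ΔF/F never has to be written). The anchor CONDENSES, elementarily and uniformly in
N: n₀(F)/N ≥ (1 − (N−1)∫(1−φ²)/L³)² (support
JastrowAnchorBEC), hence so do all near-minimisers of the parent form (support ParentHamiltonianBEC)
— a genuinely interacting (2-body well + core +
explicit 3-body) 3-D continuum Hamiltonian with thermodynamic-limit ground-state BEC for dressing
ranges b up to ξ/2 (ξ = healing length).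
TRANSFER (card (B), made N-uniform and gap-free): write any periodic N-body Ψ as Ψ(x,Y) =
D_Y(x)·g_Y(x) with the one-particle dressing
D_Y(x) = Π_j Φ(x − y_j). DressingBound (support, deterministic): if the dressed corrector g_Y is
L²-flat over the cell, L³∫|g_Y|² ≤ (1+K)|∫g_Y|², for a
set of environments Y of |Ψ|²-mass ≥ 1−η, then n₀(Ψ) ≥ (1−η)(1−√(ρJ(1+K)))²/(1+K)·N (J ≥ ∫(1−φ²)).
PinnedCorrectorFlatness (crux 2, the node):
for every ε > 0, at all small ρ, δ-near-minimisers of the periodic energy of v admit a profile of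
cut-off b whose defect is at least of scattering size,
a·b² ≤ ∫(1−φ²) (a = scattering length), and whose range is at least interparticle, ρb³ ≥ 1
(together: φ ≡ 1 is excluded when a > 0 and the defect
cannot hide inside a hard core, so the dressing is load-bearing), with flatness parameters K ≤ ε, η
≤ ε, ρJ ≤ ε, uniformly in N — i.e. COMPLETE condensation n₀/N → 1 in the dilute limit, strictly more
than the target. ParentEnergyProximity (crux 3): near-minimisers are
ε-approximate ground states of a Jastrow parent Hamiltonian, ∫F²|∇(Ψ/F)|² ≤ ερN — the quantitative
"anchor ≈ truth". FlatnessTransfer (crux 5, the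
mechanism): ParentEnergyProximity → PinnedCorrectorFlatness — approximate parent ground states have
flat dressed correctors, N-uniformly (the card's
Markov-generator / tagged-particle bet; NOT Poincaré, which only sees the N-body gap ~ L⁻²).
ParentEnergyProximity ∧ FlatnessTransfer give
PinnedCorrectorFlatness, which (support PinnedFlatnessGivesPeriodicBEC, via DressingBound) gives
PeriodicBEC (target, shared stmt-0826/8997) ⇒ the
conjunct via BoundaryTransferWeak (crux 4, shared stmt-0827).
Lean: `ParentEnergyProximity ∧ FlatnessTransfer ∧ BoundaryTransferWeak`

## Assembly
Pure composition (Sketch.lean rc 0, axioms propext / Classical.choice / Quot.sound): the deciding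
theorem is
`theorem closes (h₁ : ParentEnergyProximity) (h₂ : FlatnessTransfer) (h₃ :
PinnedFlatnessGivesPeriodicBEC) (h₄ : BoundaryTransferWeak) :
_root_.BoseEinsteinCondensation := fun v hv => h₄ v hv (h₃ (h₂ h₁) v hv)` — proximity + transfer
give PinnedCorrectorFlatness (h₂ h₁), the glue h₃
(whose proof is DressingBound + bookkeeping) gives PeriodicBEC(v), the boundary transfer (h₄) turns
it into the conjunct's body at v. PinnedCorrectorFlatness
itself is deliberately NOT a hypothesis of `closes` (it is the directly-claimable node of the
one-child glued split PinnedCorrectorFlatness ⇐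
ParentEnergyProximity with glue FlatnessTransfer), so ParentEnergyProximity is load-bearing;
DressingBound, JastrowAnchorBEC, ParentHamiltonianBEC are
supports outside the deciding chain. `example : Assembly := closes` checks that the Assembly item is
literally its type.

Rationale: WHY THIS LINE. The AKLT/Laughlin parent-Hamiltonian trick pointed at the dilute gas
(CalogeroMarchioro1973 doi:10.1063/1.1666291; card audit: KKLZ1991, KhareRay1997):
LSSY's own Dyson/Jastrow product (LiebSeiringerSolovejYngvason2005 Thm 2.2, in tree as
PeriodicBoseGasJastrow) is an EXACT ground state of an explicit
interacting Hamiltonian, and its condensation is not a cluster-expansion theorem but a five-line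
consequence of LSSY's one-particle elimination
Π(1−g_j) ≥ 1−Σg_j ((2.24)–(2.25)) and of Mayers' identity n₀/N = E_Y |∫Ψ(·,Y)|²/(L³∫|Ψ(·,Y)|²)
(Mayers2001 doi:10.1103/physrevb.64.224521, physics
level). The same two lines give the deterministic DressingBound, which converts thermodynamic-limit
condensation of the TRUE gas into a one-particle
statement: the corrector g = Ψ/D left after dividing out the pair structure seen by one particle is
flat over the cell for most environments; the
route's bet is that this flatness is reachable from the ANCHOR — near-minimisers are approximate
parent ground states (ParentEnergyProximity, an energy
estimate) and approximate parent ground states have flat dressed correctors N-uniformly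
(FlatnessTransfer, a Markov-generator / tagged-particle
statement: g_Y as principal eigenfunction of the ground-state-transformed parent generator plus a
shallow residual, with integrable t^{-3/2}
decorrelation of the tagged particle in d = 3, KipnisVaradhan1986-type). Imported areas:
classical/probabilistic conditioning (the environment average,
Cauchy–Schwarz in one coordinate), the ground-state (Doob h-) representation of Schrödinger forms,
reversible interacting diffusions (tagged particle),
Jastrow variational theory (ReattoChester1967 phonon tail as the heuristic size of Var log g ≈
ρα²/b, finite in d = 3, divergent in d = 1). Versus the
routes on file: BECPeriodicReduction only reformulates; BECJastrowKac (same splitting identity)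
files window-condensation CONCLUSIONS to be reached by
Kac–Siegert/CLT — here the anchor theorems are typed supports and the cruxes are the RELATIVE,
state-level statements (pinned flat dressed corrector;
parent-energy proximity; their implication); BECConditionalEntropy/BECPalmLandscape bound the
entropy/participation of the RAW conditional law p(·|Y) —
here the functional is applied to the DRESSED corrector on the torus, which divides out the two-body
zeros (hard cores included) and ties flatness to the
parent residual Q = Kac well − W₃. Rev-3 repair (route review rreview-0815T13-11, Lean-certified
Loophole.lean / CruxImpliedByTarget.lean on stmt-9107):
the unpinned, unquantified CorrectorFlatness was implied by the target through φ ≡ 1 + Chebyshev; it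
is replaced by PinnedCorrectorFlatness (defect
floor a·b² ≤ ∫(1−φ²) with range floor ρb³ ≥ 1 excludes φ ≡ 1 and in-core dips; K, η, ρJ ≤ ε demands
complete condensation, which no c > 0
statement yields), and ParentEnergyProximity, dangling
before, now feeds `closes` through FlatnessTransfer. Negatives index (6 entries, 1 BEC:
BECSwapAffinity.SwapJensen) shares no statement with this route.

RANKED CRUXES. #0 PeriodicBEC (target) — constant-mode BEC for δ-near-minimisers of the periodic
energy on the torus of side (N/ρ)^{1/3}, every repulsive finite-range v, all small ρ (verbatim item
stmt-AtomisticToContinuum-0826/8997, shared with BECSubharmonicContinuation); implied by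
PinnedCorrectorFlatness through the bookkeeping support PinnedFlatnessGivesPeriodicBEC (proof via
DressingBound). (why it might fail: the textbook open problem (LSSY2005 §1.2, Ch. 5); for this route
it fails only if PinnedCorrectorFlatness fails (DressingBound is deterministic).)
[LiebSeiringerSolovejYngvason2005, Fournais2020, Junge2026]
#2 PinnedCorrectorFlatness (crux) — for every repulsive finite-range v and every ε > 0 there is ρ₀ >
0 such that for 0 < ρ < ρ₀ there are a cut-off b with ρb³ ≥ 1 (range floor: at least interparticle,
so no defect can hide inside a core), a positive C¹ pair profile φ of cut-off b PINNED by the defect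
floor a·b² ≤ ∫(1−φ²) (a = scatteringLength v; the Dyson profile (1−a/r)₊/(1−a/b) has defect ≥
1.76ab² once b ≥ 4R₀), 0 ≤ K ≤ ε, 0 ≤ η ≤ ε (η < 1), J ≥ ∫(1−φ²) with ρJ ≤ ε and ρJ(1+K) < 1, such
that for all large N = n+1 there is δ > 0 with: every δ-near-minimiser Ψ of the periodic energy on
the torus of side L = (N/ρ)^{1/3} gives |Ψ|²-mass ≥ 1−η to the environments Y ∈ cell^n whose dressed
corrector g_Y = Ψ(·,Y)/Π_j pairFactor L φ (·−y_j) is K-flat, L³∫_cell|g_Y|² ≤ (1+K)|∫_cell g_Y|².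
Via DressingBound: liminf n₀/N ≥ (1−ε)(1−√(ε(1+ε)))²/(1+ε) → 1, complete condensation in the dilute
limit — strictly stronger than the target, so not Chebyshev-invertible from it; the pin makes the
dressing load-bearing (Ψ/D_Y is L²-controlled only if Ψ carries the pair dips of D_Y). Directly
claimable node; its glued one-child split is #3 + #5. [difficulty: open-problem] (why it might fail:
demands complete condensation (K,η→0 as ρ→0) of all δ-near-minimisers, N-uniformly, with a
scattering-size dressing: false if the depletion of the thermodynamic-limit ground state does not
vanish as ρa³→0, if fixed-N phase rigidity fails (hard shells), and in every d = 1 analogue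
(Girardeau).) [LiebSeiringerSolovejYngvason2005 Ch. 5 (5.2) and Thm 5.1, BoccatoEtAl2017 =
doi:10.1007/s00220-017-3016-5, AdhikariBrenneckeSchlein2020 = doi:10.1007/s00023-020-01004-1,
Fournais2020 Thm 1.2 (in tree, proved: Fournais2020_condensation_holds), Mayers2001 =
doi:10.1103/physrevb.64.224521, ReattoChester1967 = doi:10.1103/physrev.155.88,
book:pethick2008-boseeinstein-condensation-dilute-gases p.184, Loophole.lean +
CruxImpliedByTarget.lean (refuter rreview-0815T13-11, evidence on stmt-9107),
Literature.Barriers.AtomisticToContinuum.OneDimensionalHardCore,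
Literature.Barriers.AtomisticToContinuum.KineticGapLengthScales]
#3 ParentEnergyProximity (crux) — for every repulsive finite-range v and every ε > 0 there is ρ₀ > 0
such that for 0 < ρ < ρ₀ some positive C¹ pair profile φ (cut-off b; intended: the
zero-scattering-length Dyson/Neumann function of v at b = Mρ^{-1/3}, smoothed) makes every
δ-near-minimiser Ψ of the periodic energy (N = n+1 large, δ = δ(N) > 0, L = (N/ρ)^{1/3}) an
ε-approximate ground state of the parent Hamiltonian of F = Π_{i<j}Φ(x_i−x_j): ∫_{cell^N}
F²|∇(Ψ/F)|² ≤ ερN. Route to it: the identity E_v[Fg] = ∫F²|∇g|² + ∫|Fg|²(ε_wΣw − W₃), the proved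
upper bound E₀ ≤ 4πaρN(1+o(1)) (LSSY2005_upperBound_periodic_holds), the free positive-definite pair
count ⟨Σ_{i<j}w⟩ ≥ ½N(ρŵ(0) − w(0)), and a three-body bound on ⟨W₃⟩. Consumed by `closes` through
FlatnessTransfer (no longer dangling). [difficulty: L] (why it might fail: needs
⟨W₃⟩_Ψ=⟨Σ_iΣ_{j≠k}∇logφ_ij·∇logφ_ik⟩ ≲ (ρab²)·aρN for near-minimisers — a three-body (second
local-density moment) bound at scale b≫ρ^{-1/3} not in print for TL ground states; cores force
θ-regularised φ with ∇logφ∼1/θ at contact.) [LiebSeiringerSolovejYngvason2005 Thm 2.2 and Lemma 2.5,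
Literature.MathematicalPhysics.QuantumManyBody.BoseGas.LSSY2005_upperBound_periodic,
Literature.MathematicalPhysics.QuantumManyBody.BoseGas.LSSY2005_dysonProfile, CalogeroMarchioro1973
= doi:10.1063/1.1666291, BastiCenatiempoSchlein2021 = doi:10.1017/fms.2021.66, FournaisSolovej2020,
Literature.Barriers.AtomisticToContinuum.KineticGapLengthScales]
#4 BoundaryTransferWeak (crux) — for each repulsive finite-range v, PeriodicBEC-body(v) ⇒ ∃ρ₀
∀ρ∈(0,ρ₀) HasGroundStateBEC v ρ (Dirichlet, mode-free) — verbatim item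
stmt-AtomisticToContinuum-0827 (shared with BECLiebAntibunching, BECRieszShadow,
BECSubharmonicContinuation, …). Not glue: near-minimiser slacks O(N/L²) vs wall energy ≫ N/L²;
expected via Neumann bracketing of interior sub-boxes + λ_max ≥ tr γ²/N. [difficulty: L] (why it
might fail: PeriodicBEC(v) is ground-state-only (δ after N); the Dirichlet GS restricted to interior
boxes is neither periodic nor of sharp N, so the hypothesis may never fire (transfer ≈ conjunct);
BEC can be BC-sensitive (Robinson 1976).) [LiebSeiringerSolovejYngvason2005 Ch. 2 after (2.8),
Basti2022 = arXiv:2203.01841, BoccatoSeiringer2023 = arXiv:2205.15284, Junge2026 = arXiv:2603.20776,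
Robinson1976 = doi:10.1007/bf01608554]
#5 FlatnessTransfer (crux) — ParentEnergyProximity → PinnedCorrectorFlatness: ε-approximate parent
ground states among the near-minimisers have pinned, ε-flat dressed correctors, N-uniformly — the
anchor-to-truth transfer, i.e. the route's mechanism as an item and the glue of the one-child split
of #2 by #3 (rank 5 only so that it renders after the decls it names; it is the XL bet of the line).
Intended proof: RegularEnvironments (|Ψ|²-most Y have local counts ≤ Mρb³ in b-balls, from
second-moment bounds of the parent-form type) + RegularFlatness (for regular Y, g_Y is the principal
eigenfunction of −L_F + Q on L²(F²dX), L_F the F²-reversible dilute diffusion, Q = ε_wΣw − W₃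
shallow; Feynman–Kac with a tagged-particle influence bound, integrable t^{-3/2} decorrelation in d
= 3). [difficulty: XL] (why it might fail: a parent form ≤ ερN bounds Var(g) only via the N-body gap
~L⁻² (KineticGapLengthScales: void as L→∞); the real bet — g_Y a principal eigenfunction +
integrable (t^{-3/2}, d=3) tagged-particle decorrelation, N-uniform — has no printed form and fails
in d=1.) [LiebSeiringerSolovejYngvason2005 Lemma 4.3 and Ch. 7 (7.5), KipnisVaradhan1986 =
doi:10.1007/bf01210789, CalogeroMarchioro1973 = doi:10.1063/1.1666291, ReattoChester1967 =
doi:10.1103/physrev.155.88, Literature.Barriers.AtomisticToContinuum.KineticGapLengthScales,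
Literature.Barriers.AtomisticToContinuum.OneDimensionalHardCore]
#9 JastrowAnchorBEC (support) — the anchor condenses, deterministically: for every pair profile φ of
cut-off b (0 < 2b < L), every N and I ≥ ∫(1−φ²) with (N−1)I < L³, the normalised Jastrow product
Π_{i<j}Φ(x_i−x_j)/‖·‖ on the torus of side L has constant-mode occupation ≥ (1 − (N−1)I/L³)²·N.
Proof: n₀/N = ∫ L³|m(Y)|²dY with m = cell-mean of Ψ(·,Y); Π_jΦ(x−y_j) ≥ 1 − Σ_j(1−Φ(x−y_j)) (LSSY
(2.24)–(2.25)) gives cell-mean ≥ 1 − (N−1)I/L³ while the cell-mean-square is ≤ 1. With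
LSSY2005_dysonProfile (I ≤ 16πab²): n₀/N ≥ 1/4 for b ≤ ξ/2, ξ = (8πρa)^{-1/2}. [difficulty:
provable-now] [LiebSeiringerSolovejYngvason2005 Thm 2.2 proof (2.22)–(2.26), Mayers2001 =
doi:10.1103/physrevb.64.224521, PenroseOnsager1956 §6, Griffin1993 p.188]
#9 DressingBound (support) — deterministic dressing transfer at fixed N = n+1, L, positive profile φ
(0 < 2b < L), K, J ≥ ∫(1−φ²) with nJ(1+K) < L³: for every periodic trial state Ψ,
(n+1)(1−√(nJ(1+K)/L³))²/(1+K) × [|Ψ|²-mass of the environments Y ∈ cell^n whose dressed corrector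
g_Y = Ψ(·,Y)/Π_jΦ(·−y_j) satisfies L³∫_cell|g_Y|² ≤ (1+K)|∫_cell g_Y|²] ≤ n₀(Ψ). Proof: |∫Dg| ≥ |∫g|
− √(∫(1−D))·√(∫|g|²), ∫_cell(1−D) ≤ nJ, ∫|Dg|² ≤ ∫|g|² (both supports audited TRUE by refuter
g40-60). [difficulty: provable-now] [Mayers2001 = doi:10.1103/physrevb.64.224521,
LiebSeiringerSolovejYngvason2005 (2.24)–(2.25)]
#9 ParentHamiltonianBEC (support) — the card's theorem-candidate (A) in near-minimiser form: for
every positive pair profile φ (cut-off b), J ≥ ∫(1−φ²) and density with 2ρJ ≤ 1, for all large N =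
n+1 there is δ > 0 such that every periodic trial state Ψ whose parent form ∫_{cell^N}F²|∇(Ψ/F)|² is
≤ δ (every δ-near-minimiser of the parent Hamiltonian H_F = −Δ + ΔF/F ≥ 0, whose ground state is the
Jastrow state F) has constant-mode occupation ≥ N/8 on the torus of side (N/ρ)^{1/3}. Proof:
weighted Poincaré on the torus at fixed N (F² ∈ [θ^{N(N−1)},1]) ⇒ Ψ ≈ cF in L²; √(n₀/N) is
1-Lipschitz in Ψ; JastrowAnchorBEC. [difficulty: M] [CalogeroMarchioro1973 = doi:10.1063/1.1666291,
LiebSeiringerSolovejYngvason2005 Lemma 4.1 (in tree: LSSY2005_lemma41_periodic,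
neumannPoincare_boxN), ReedSimonIV1978 XIII.12]
#9 PinnedFlatnessGivesPeriodicBEC (support) — bookkeeping glue PinnedCorrectorFlatness → PeriodicBEC
(replaces FlatnessGivesPeriodicBEC stmt-9112; DressingBound is the lemma of its proof, not a
hypothesis): given v admissible, instantiate the crux at ε := 1/2 to get ρ₀ and, per ρ, (b, K, η, J,
φ) with ρJ(1+K) < 1, η < 1 and, eventually in n, flat-mass ≥ 1−η for all δ-near-minimisers; for n
large also 2b < L = ((n+1)/ρ)^{1/3} (tendsto_sideLength) and nJ(1+K)/L³ = ρJ(1+K)·n/(n+1) < 1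
(div_sideLength_pow_three), so DressingBound applies and gives n₀ ≥ c(n+1) with c :=
(1−η)(1−√(ρJ(1+K)))²/(1+K) > 0 ((1−√t)² antitone; ENNReal.ofReal_mul; shift N = n+1 in
Filter.eventually_atTop); the ε-conjuncts and the pin are not used. [difficulty: provable-now]
[LiebSeiringerSolovejYngvason2005,
Literature.MathematicalPhysics.QuantumManyBody.BoseGas.div_sideLength_pow_three]

TWO-LAYER PLAN. In place at rev 3: the one-child glued split PinnedCorrectorFlatness ⇐
ParentEnergyProximity with glue FlatnessTransfer (`closes` consumes the
children, the node stays directly claimable). Foreseen, not filed (k ≤ 3, depth 1 each):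
FlatnessTransfer ⇐ RegularEnvironments → RegularFlatness →
FlatnessTransfer, RegularEnvironments = under the parent-form bound |Ψ|²-most Y are (b,M)-regular
(local counts in b-balls ≤ Mρb³, no core clusters —
second-moment bounds), RegularFlatness = for regular Y the dressed corrector of the (unique,
positive) ground state is K-flat with K ≤ C(a/b + (ρa³)^{1/2})
(the Markov-generator bet above); ParentEnergyProximity ⇐ ParentIdentity → ResidualLowerBound →
ParentEnergyProximity: ParentIdentity =
E_v[Fg] = ∫F²|∇g|² + ∫|Fg|²(Σ(v − 2Δφ/φ) − W₃) for C² positive profiles (integration by parts on the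
torus); ResidualLowerBound = ε_w⟨Σw⟩ − ⟨W₃⟩ ≥
E₀^per − ερN for near-minimisers (positive-definite pair counting + three-body moment bound).

KILL CRITERIA. ¬PinnedCorrectorFlatness for some admissible v (e.g. a proof that the
thermodynamic-limit depletion of near-minimisers stays ≥ c₀ > 0 as ρa³ → 0,
or that for every scattering-size dressing the flat-mass of the dressed corrector tends to 0 / Var_x
log|g| → ∞) closes the route (close --reason
refuted:PinnedCorrectorFlatness): it refutes FlatnessTransfer ∧ ParentEnergyProximity jointly; note
that it would NOT refute BEC itself (the crux is the
complete-condensation strengthening) — a refuter exhibiting incomplete-but-positive condensation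
sends the line back to an ε-free pinned crux (restate,
not cosmetic: the pin stays). ¬ParentEnergyProximity (the true near-minimisers are not approximate
parent ground states for ANY positive C¹ profile) kills
the parent-Hamiltonian engine and BECJastrowKac's dressed window at once ⇒ pivot:
PinnedCorrectorFlatness directly with non-Jastrow (three-body-corrected)
dressings, FlatnessTransfer mooted. ¬FlatnessTransfer alone (= ParentEnergyProximity ∧
¬PinnedCorrectorFlatness) is the first kill restated.
¬BoundaryTransferWeak kills the Dirichlet transfer for every torus route (shared fate with
BECLiebAntibunching, BECRieszShadow, BECSubharmonicContinuation).
PeriodicBEC proved elsewhere moots cruxes 2, 3, 5 (close --reason superseded).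

NOT DECOMPOSED YET. The parent profile itself (zero-scattering-length Neumann/Dyson function of v −
ε_w w with smooth flat continuation, LSSY Lemma 2.5 objects; for hard
cores a θ-regularised positive version; its defect ≥ a·b² for b ≥ 4R₀ is the two-line estimate
1−f_b² ≥ a/r − a/b on (R₀,b)) — a lemma under
ParentEnergyProximity / PinnedCorrectorFlatness (--supports), deliberately existential in the
cruxes; the N-body parent identity and the W₃ bound (layer-2
children above); RegularEnvironments / RegularFlatness (layer-2 children of FlatnessTransfer above,
filed only when a prover asks or #3 closes);
ground-state uniqueness/positivity and the fixed-N gap on the torus (inside PinnedCorrectorFlatness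
for complex near-minimisers; the periodic twin of
GroundStateRigidity is the shared item PeriodicRigidity stmt-AtomisticToContinuum-9467 of
BECLiebAntibunching/BECRieszShadow — attach only if a prover asks);
weighted Poincaré at fixed N (inside ParentHamiltonianBEC); the card's deformation family H_t = H_F
+ tQ, t ∈ [0,1], is NOT filed as "∀t BEC_t"; finiteness
of E₀^per (hard cores: low density); T > 0; anything Dirichlet beyond BoundaryTransferWeak. The
retired decls CorrectorFlatness (stmt-9107, target-equivalent
as typed) and FlatnessGivesPeriodicBEC (stmt-9112) are dropped from the route, not restated in
place.

CHEAPEST FALSIFIER. (i) Dimension test, one kit job or one page: on the explicit 1-D Girardeau state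
Ψ_N = ΠΠ|sin(π(x_k−x_j)/L)| (OneDimensionalHardCore, λ_max ~ √N) the
1-D analogue of DressingBound holds verbatim, so the flat-mass of the dressed corrector MUST tend to
0 for every short-range dressing — compute
CV²_x(Ψ_N(x,Y)/Π_jφ(x−y_j)) for typical Y, N = 10…400 at fixed density: if it stays bounded, the
crux/glue pair is mis-typed. (ii) Lean, minutes (junk
audit of the repaired crux, all three checked rc 0 in Sketch.lean): the defect pin is vacuous at a =
0 (free gas keeps φ ≡ 1, b = ρ^{-1/3}), profileDefect 1 = 0
so φ ≡ 1 violates the floor as soon as a·b² > 0, and the ε-conjuncts are monotone (ε ↦ weaker); then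
instantiate DressingBound at n = 0 and JastrowAnchorBEC at
N = 0, 1 as before. (iii) Physics, one page: with LSSY's Dyson profile at b = Mρ^{-1/3}, is ⟨W₃⟩ in
the Jastrow measure F² itself ≤ C(ρab²)·aρN (classical
three-body integral ρ²∫∫q(r)q(r′)g₃)? If already the anchor violates it, ParentEnergyProximity is
dead as stated. (iv) Lookup: a printed thermodynamic-limit
LOWER bound on the depletion that does not vanish as ρa³ → 0 would kill #2 at once (none known:
Bogoliubov theory predicts 1 − n₀/N ≈ (8/3√π)(ρa³)^{1/2},
book:pethick2008-boseeinstein-condensation-dilute-gases p.184;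
rigorous results are upper bounds on n₊ in GP/beyond-GP boxes, BoccatoEtAl2017,
AdhikariBrenneckeSchlein2020, Fournais2020).

NUMBERS. ξ = (8πρa)^{-1/2}; LSSY2005_dysonProfile (proved): I = ∫(1−f²) ≤ 16πab², so
JastrowAnchorBEC gives n₀/N ≥ (1−16πρab²)² ≥ 1/4 iff b ≤ (32πρa)^{-1/2} =
ξ/2. Defect floor: for f_b = (1−a/r)₊/(1−a/b) continued by 1, ∫_{R₀<r<b}(1−f_b²) ≥ 4πa(b²/6 − R₀²/2
+ R₀³/(3b)) ≥ 1.76·ab² at b ≥ 4R₀ (floor constant 1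
leaves room for C¹ smoothing and θ-regularisation); with ρb³ ≥ 1, ρJ ≤ ε and J ≈ (4π/3…16π)ab² the
admissible window is ρ^{-1/3} ≤ b ≲ (ε/(16πρa))^{1/2} =
ξ(ε/2)^{1/2}, non-empty iff (ρa³)^{1/3} ≲ ε/16π, i.e. for ρ < ρ₀(ε, v), and it contains b =
Mρ^{-1/3} (ρab² = M²aρ^{1/3} → 0); a·b² ≥ aρ^{-2/3} ≫ R₀³
there, so the defect cannot sit inside the core r < R₀ where Ψ vanishes. Complete-condensation
constant: (1−ε)(1−√(ε(1+ε)))²/(1+ε) ≥ 1 − 4√ε for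
ε ≤ 1/16. Expected K ~ a/b + O((ρa³)^{1/2}) (Jastrow depletion ρ∫(1−f)² ≈ 4πρa²b, Bogoliubov order
at b ~ ξ). Parent residual:
Neumann/Kac well depth ε_b ≈ 6a/b³ (∫ε_b1_{B_b} ≈ 8πa), ⟨W₃⟩/N ~ ρa·O(ρab²); window for crux 3:
ρ^{-1/3} ≪ b ≪ ξ (b = Mρ^{-1/3}, errors a/b + M^{-3} +
M²aρ^{1/3} + (ρa³)^{1/3}). Heuristic size of the flatness defect: Var_x log g_Y ≈ πρα²/b with the
Reatto–Chester coefficient α = mc/(2π²ħρ)-type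
(Griffin1993 (9.3)), i.e. O(a/b) in 3D; ∫dk/k-divergent in 1D. Items after the rev-3 repair: 9 (4
cruxes, 1 target, 4 supports, 1 assembly) + `closes`.

DEFINITION REQUESTS. None filed: every item is typed over existing BoseGas declarations
(PeriodicTrialState, periodicEnergy, periodicGroundStateEnergy,
condensateOccupation, sideLength, cell, cellN, Config, Space, IsPairProfile, pairFactor, jastrow,
jastrowNormR, profileDefect, scatteringLength,
kineticDensity, IsRepulsiveFiniteRange, HasGroundStateBEC; Sketch.lean rc 0). Cone audit (rev 3):
the used-constants cone has 46 project constants, all proved down to Mathlib except the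
sub-problem Statement and its own vocabulary (IsRepulsiveFiniteRange, HasGroundStateBEC —
summit-grade); no Literature fact is needed as a hypothesis.
Literature request on file: acq-01260 (Mayers2001, cite-only).

Novelty: Searches (2026-08-15): `lit frontier AtomisticToContinuum --since 2020` (30 rows; BEC descendants
arXiv:2603.20776, arXiv:2510.20493, arXiv:2602.16566 —
all kinetic localisation); `lit bridges AtomisticToContinuum --cross any` (30 rows, no Bose-gas
bridge); `lit search --source crossref` ×7 ("Jastrow
wave function BEC condensate fraction ODLRO" → Mayers2001 doi:10.1103/physrevb.64.224521,
Girardeau1965 doi:10.1063/1.1704372; "Mayers phase coherence"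
→ doi:10.1103/physrevlett.92.135302, doi:10.1103/physrevb.74.014516; "Reatto Chester Jastrow" →
doi:10.1103/physrev.155.88, doi:10.1103/physreva.18.296;
"free volume condensate fraction hard sphere Penrose Onsager" → doi:10.1103/physrev.104.576;
"Jastrow trial state hard spheres GP" →
doi:10.1007/s00220-022-04547-y, doi:10.1017/fms.2021.66, doi:10.1007/s00205-024-02049-w; "parent
Hamiltonian exact Jastrow ground state bosons
three-body" → doi:10.1063/1.1666291, doi:10.21468/scipostphys.8.3.042); `lit search --hybrid` + `lit
vsearch` (held: Griffin1993 pp.182–188 READ,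
LSSY2005 pp.56–57 READ, Binder1992 p.259 READ); `lit galaxy search --star all` ×4 (substring: 0 hits
"Jastrow condensate fraction"; 3 queries
saturated, logged) + `--star panama --title-contains Bose "condensate fraction"` (8 books, none
new); OpenAlex/S2/arXiv HTTP 429 this pass; the
card's two novelty audits (CalogeroMarchioro1973, Sutherland1971, KKLZ1991, KhareRay1997,
Reatto1969, Ruelle1969) stand; in-tree: routes
BECJastrowKac / BECConditionalEntropy / BECPalmL  [refs: 10.1103/physrevb.64.224521, 10.1063/1.1704372, 10.1103/physrevlett.92.135302, 10.1103/physrevb.74.014516, 10.1103/physrev.155.88, 10.1103/physreva.18.296, 10.1103/physrev.104.576, 10.1007/s00220-022-04547-y, 10.1017/fms.2021.66, 10.1007/s00205-024-02049-w, 10.1063/1.1666291, 10.21468/scipostphys.8.3.042, 2603.20776, 2510.20493, 2602.16566, doi:10.1103/physrevb.64.224521, doi:10.1063/1.1704372, doi]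

Barriers (technique_class: parent-hamiltonian, jastrow-dressing, conditional-flatness): - technique_class: parent-hamiltonian, jastrow-dressing, conditional-flatness
- Literature.Barriers.AtomisticToContinuum.KineticGapLengthScales:
CorrectorFlatness/DressingBound/JastrowAnchorBEC are gap-free and N-uniform by construction (the
dressing bound is deterministic per environment, no L² factor, δ chosen after N so the Galilei-boost
lemma of KineticGapLengthScalesNarrow does not bite); CONCEDED for ParentEnergyProximity used alone:
small weighted Dirichlet energy + weighted Poincaré gives BEC only while L²ερ ≲ 1 (GP-type scales) —
it is filed as the quantitative anchor≈truth input of layer 2, not as a road to the thermodynamic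
limit; ParentHamiltonianBEC uses the fixed-N gap legitimately (δ after N).
- Literature.Barriers.AtomisticToContinuum.EnergyAsymptoticsWithoutCondensation: evaded — no item
infers condensation from energy asymptotics; energies enter only ParentEnergyProximity as relative
smallness of a Dirichlet form, and the 1-D Lieb–Liniger witness is consistent (in d = 1 energy
proximity can hold while CorrectorFlatness fails).
- Literature.Barriers.AtomisticToContinuum.BogoliubovPerturbationInfrared: it does not expand around
the Bogoliubov state; the bet is that the flatness defect is an equal-time static variance Var_x log
g_Y ≈ ρ∫_{r>b}δu² = O(ρα²/b), infrared-finite in d = 3 (the ω-integrals of the barrier never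
appear), with the d = 1 divergence as the built-in consistency check.
- Literature.Barriers.AtomisticToContinuum.PitaevskiiStringariOneDimension

History (route lifecycle, newest last):
- 2026-08-15T14:00:13Z · rev 1: dropped stmt-AtomisticToContinuum-8997 — repair after interrupted route-open: drop the kind-less attachment of 8997 and re-attach it as the rank-0 target PeriodicBEC; attach shared crux BoundaryTransfe (planner-plancard-AtomisticToContinuum-BoseEin-cd042693-0)
- 2026-08-15T16:55:57Z · rev 3: restated Assembly (stmt-AtomisticToContinuum-9113) — route-repair (cone + route-review objections), rev 3: (cone) the used-constants cone is clean — 46 consts, the 4 counted 'unproved' are the Statement and its ow (planner-rrepair-AtomisticToContinuum-BECParent-b31733a0-g2-0)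
- 2026-08-15T16:55:57Z · rev 3: dropped CorrectorFlatness, FlatnessGivesPeriodicBEC — route-repair (cone + route-review objections), rev 3: (cone) the used-constants cone is clean — 46 consts, the 4 counted 'unproved' are the Statement and its ow (planner-rrepair-AtomisticToContinuum-BECParent-b31733a0-g2-0)
- 2026-08-25T01:39:37Z · DORMANT — reconciler: no traction for 7.3 d (last activity item-evidence-added at 2026-08-17T18:55:01Z); parked, not closed — `ledger route dormant route-AtomisticToConti (operator:999:22683)
- 2026-08-29T03:25:29Z · REACTIVATED — reconciler: reactivated — activity statement-checked at 2026-08-29T01:17:37Z after parking at 2026-08-25T01:39:37Z (operator:999:84394)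
- 2026-08-29T19:28:16Z · DORMANT — census g0: costume|duplicate of —; reader census-reader-32-g0 (operator:999:960220)
- 2026-08-29T21:06:09Z · REACTIVATED — census: dormancy REVERTED — g1 reader + census-trib-costume-C class it NOT-COSTUME (21-frontier 20:08:25Z: no single-read elimination) (operator:999:1957195)

sub-problem: BoseEinsteinCondensation · status: open · opened planner-plancard-AtomisticToContinuum-BoseEin-cd042693-0 2026-08-15T13:48:25Z · rev 3 · ledger route-AtomisticToContinuum-BECParentAnchor
GENERATED by the gate from the ledger (D-0016/17). Provers cite these decls: `theorem foo : Summit.AtomisticToContinuum.BoseEinsteinCondensation.Theses.BECParentAnchor.<Decl> := …` in Summits/AtomisticToContinuum/BoseEinsteinCondensation/Theorems/<Name>.lean.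
-/

namespace Summit.AtomisticToContinuum.BoseEinsteinCondensation.Theses.BECParentAnchor

open scoped BigOperators Topology Manifold Classical MeasureTheory ProbabilityTheory Matrix InnerProductSpace ComplexConjugate ContinuousMap
open Filter Set Function TopologicalSpace MeasureTheory

attribute [summit_statement] _root_.BoseEinsteinCondensation

/-- item stmt-AtomisticToContinuum-8997 · target · rank 0 · open · by planner
why it might fail: the textbook open problem (LSSY2005 §1.2, Ch. 5); for this route it fails iff CorrectorFlatness fails (DressingBound is deterministic).
sources: LiebSeiringerSolovejYngvason2005, Fournais2020, Junge2026
[target] constant-mode BEC for δ-near-minimisers of the periodic N-body energy on the torus of side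
(N/ρ)^{1/3} at all small densities — verbatim the signature of BECPeriodicReduction.PeriodicBEC
(stmt-AtomisticToContinuum-0826); what X buys through ContinuationToPeriodicBEC (or
CoreSubharmonicCoherence through CoreContinuation). -/
@[route_item "route-AtomisticToContinuum-BECParentAnchor"]
def PeriodicBEC : Prop :=
  ∀ v : ℝ → ENNReal, Literature.MathematicalPhysics.QuantumManyBody.BoseGas.IsRepulsiveFiniteRange v → ∃ ρ₀ : ℝ, 0 < ρ₀ ∧ ∀ ρ : ℝ, 0 < ρ → ρ < ρ₀ → ∃ c : ℝ, 0 < c ∧ ∀ᶠ N : ℕ in Filter.atTop, ∃ δ : ENNReal, 0 < δ ∧ ∀ Ψ : Literature.MathematicalPhysics.QuantumManyBody.BoseGas.PeriodicTrialState N (Literature.MathematicalPhysics.QuantumManyBody.BoseGas.sideLength ρ N), Literature.MathematicalPhysics.QuantumManyBody.BoseGas.periodicEnergy v Ψ ≤ Literature.MathematicalPhysics.QuantumManyBody.BoseGas.periodicGroundStateEnergy v N (Literature.MathematicalPhysics.QuantumManyBody.BoseGas.sideLength ρ N) + δ → ENNReal.ofReal (c * N) ≤ Literature.MathematicalPhysics.QuantumManyBody.BoseGas.condensateOccupation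 N (Literature.MathematicalPhysics.QuantumManyBody.BoseGas.sideLength ρ N) Ψ.ψ

/-- item stmt-AtomisticToContinuum-11261 · crux · rank 2 · open · by planner
why it might fail: demands complete condensation (K,η→0 as ρ→0) of all δ-near-minimisers, N-uniformly, with a scattering-size dressing of range ≥ ρ^{-1/3}: false if the TL depletion does not vanish as ρa³→0, if fixed-N phase rigidity fails (hard shells), and in every d = 1 analogue (Girardeau).
sources: LiebSeiringerSolovejYngvason2005 Ch. 5 (5.2) and Thm 5.1, BoccatoEtAl2017 = doi:10.1007/s00220-017-3016-5, AdhikariBrenneckeSchlein2020 = doi:10.1007/s00023-020-01004-1, Fournais2020 Thm 1.2 (in tree, proved: Fournais2020_condensation_holds), Mayers2001 = doi:10.1103/physrevb.64.224521, ReattoChester1967 = doi:10.1103/physrev.155.88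
[crux] SHARPENED + PINNED dressed-corrector flatness (repair of CorrectorFlatness stmt-9107, which
the route review rreview-0815T13-11 — Loophole.lean / CruxImpliedByTarget.lean, Lean-certified —
showed to be implied by the target via φ ≡ 1 + Chebyshev): for every repulsive finite-range v and
every ε > 0 there is ρ₀ > 0 such that for 0 < ρ < ρ₀ there are a cut-off b with RANGE FLOOR ρb³ ≥ 1
(dressing range at least interparticle — the many-body regime b = Mρ^{-1/3} of the parent profile —
so that no admissible defect can hide inside a hard core where Ψ vanishes), a positive C¹ pair
profile φ (IsPairProfile b φ) PINNED to the interaction by the DEFECT FLOOR a·b² ≤ ∫(1−φ²) (a =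
scatteringLength v; excludes φ ≡ 1 whenever a > 0; satisfied by the Dyson/scattering profile
(1−a/r)₊/(1−a/b) continued by 1, whose defect is ≥ 1.76ab² once b ≥ 4R₀), and flatness parameters 0
≤ K ≤ ε, 0 ≤ η ≤ ε (η < 1), J ≥ ∫(1−φ²) with ρJ ≤ ε and ρJ(1+K) < 1, such that for all large N = n+1
there is δ > 0 with: every δ-near-minimiser Ψ of the periodic energy on the torus of side L =
(N/ρ)^{1/3} gives |Ψ|²-mass ≥ 1−η to the environments Y ∈ cell^n whose dressed corrector g_Y(x) =
Ψ(x,Y)/Π_j pairFactor L φ (x -/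
@[route_item "route-AtomisticToContinuum-BECParentAnchor"]
def PinnedCorrectorFlatness : Prop :=
  ∀ v : ℝ → ENNReal, Literature.MathematicalPhysics.QuantumManyBody.BoseGas.IsRepulsiveFiniteRange v → ∀ ε : ℝ, 0 < ε → ∃ ρ₀ : ℝ, 0 < ρ₀ ∧ ∀ ρ : ℝ, 0 < ρ → ρ < ρ₀ → ∃ (b K η J : ℝ) (φ : Literature.MathematicalPhysics.QuantumManyBody.BoseGas.Space → ℝ), Literature.MathematicalPhysics.QuantumManyBody.BoseGas.IsPairProfile b φ ∧ (∀ x, 0 < φ x) ∧ 0 < b ∧ 0 ≤ K ∧ K ≤ ε ∧ 0 ≤ η ∧ η ≤ ε ∧ η < 1 ∧ 0 ≤ J ∧ Literature.MathematicalPhysics.QuantumManyBody.BoseGas.profileDefect φ ≤ ENNReal.ofReal J ∧ ρ * J ≤ ε ∧ ρ * J * (1 + K) < 1 ∧ 1 ≤ ρ * b ^ 3 ∧ ENNReal.ofReal ((Literature.MathematicalPhysics.QuantumManyBody.BoseGas.scatteringLength v).toReal * b ^ 2) ≤ Literature.MathematicalPhysics.QuantumManyBody.BoseGas.profileDefect φ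 ∧ ∀ᶠ n : ℕ in Filter.atTop, let L : ℝ := Literature.MathematicalPhysics.QuantumManyBody.BoseGas.sideLength ρ (n + 1); ∃ δ : ENNReal, 0 < δ ∧ ∀ Ψ : Literature.MathematicalPhysics.QuantumManyBody.BoseGas.PeriodicTrialState (n + 1) L, Literature.MathematicalPhysics.QuantumManyBody.BoseGas.periodicEnergy v Ψ ≤ Literature.MathematicalPhysics.QuantumManyBody.BoseGas.periodicGroundStateEnergy v (n + 1) L + δ → ENNReal.ofReal (1 - η) ≤ ∫⁻ Y in {Y : Literature.MathematicalPhysics.QuantumManyBody.BoseGas.Config n | Y ∈ Literature.MathematicalPhysics.QuantumManyBody.BoseGas.cellN n L ∧ ENNReal.ofReal (L ^ 3) * (∫⁻ x in Literature.MathematicalPhysics.QuantumManyBody.BoseGas.cell L, (‖Ψ.ψ (Matrix.vecCons x Y) / ∏ j, (Literature.MathematicalPhysics.QuantumManyBody.BoseGas.pairFactor L φ (x - Y j) : ℂ)‖₊ : ENNReal) ^ 2) ≤ ENNReal.ofReal (1 + K) * (‖∫ x in Literature.MathematicalPhysics.QuantumManyBody.BoseGas.cell L, Ψ.ψ (Matrix.vecCons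 x Y) / ∏ j, (Literature.MathematicalPhysics.QuantumManyBody.BoseGas.pairFactor L φ (x - Y j) : ℂ)‖₊ : ENNReal) ^ 2}, ∫⁻ x in Literature.MathematicalPhysics.QuantumManyBody.BoseGas.cell L, (‖Ψ.ψ (Matrix.vecCons x Y)‖₊ : ENNReal) ^ 2

/-- item stmt-AtomisticToContinuum-9108 · crux · rank 3 · open · by planner
why it might fail: needs ⟨W₃⟩_Ψ=⟨Σ_iΣ_{j≠k}∇logφ_ij·∇logφ_ik⟩ ≲ (ρab²)·aρN for near-minimisers — a three-body (second local-density moment) bound at scale b≫ρ^{-1/3} not in print for TL ground states; cores force θ-regularised φ with ∇logφ∼1/θ at contact.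
sources: LiebSeiringerSolovejYngvason2005 Thm 2.2 and Lemma 2.5, Literature.MathematicalPhysics.QuantumManyBody.BoseGas.LSSY2005_upperBound_periodic, Literature.MathematicalPhysics.QuantumManyBody.BoseGas.LSSY2005_dysonProfile, CalogeroMarchioro1973 = doi:10.1063/1.1666291, BastiCenatiempoSchlein2021 = doi:10.1017/fms.2021.66, FournaisSolovej2020
[crux] for every repulsive finite-range v and every ε > 0 there is ρ₀ > 0 such that for 0 < ρ < ρ₀
some positive C¹ pair profile φ (cut-off b; intended: the zero-scattering-length Dyson/Neumann
function of v at b = Mρ^{-1/3}, smoothed) makes every δ-near-minimiser Ψ of the periodic energy (N =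
n+1 large, δ = δ(N) > 0, L = (N/ρ)^{1/3}) an ε-approximate ground state of the parent Hamiltonian of
F = Π_{i<j}Φ(x_i−x_j): ∫_{cell^N} F²|∇(Ψ/F)|² ≤ ερN. Route to it: the identity E_v[Fg] = ∫F²|∇g|² +
∫|Fg|²(ε_wΣw − W₃), the proved upper bound E₀ ≤ 4πaρN(1+o(1)) (LSSY2005_upperBound_periodic_holds),
the free positive-definite pair count ⟨Σ_{i<j}w⟩ ≥ ½N(ρŵ(0) − w(0)), and a three-body bound on ⟨W₃⟩.
[difficulty: L] -/
@[route_item "route-AtomisticToContinuum-BECParentAnchor", crux]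
def ParentEnergyProximity : Prop :=
  ∀ v : ℝ → ENNReal, Literature.MathematicalPhysics.QuantumManyBody.BoseGas.IsRepulsiveFiniteRange v → ∀ ε : ℝ, 0 < ε → ∃ ρ₀ : ℝ, 0 < ρ₀ ∧ ∀ ρ : ℝ, 0 < ρ → ρ < ρ₀ → ∃ (b : ℝ) (φ : Literature.MathematicalPhysics.QuantumManyBody.BoseGas.Space → ℝ), Literature.MathematicalPhysics.QuantumManyBody.BoseGas.IsPairProfile b φ ∧ (∀ x, 0 < φ x) ∧ 0 < b ∧ ∀ᶠ n : ℕ in Filter.atTop, let L : ℝ := Literature.MathematicalPhysics.QuantumManyBody.BoseGas.sideLength ρ (n + 1); ∃ δ : ENNReal, 0 < δ ∧ ∀ Ψ : Literature.MathematicalPhysics.QuantumManyBody.BoseGas.PeriodicTrialState (n + 1) L, Literature.MathematicalPhysics.QuantumManyBody.BoseGas.periodicEnergy v Ψ ≤ Literature.MathematicalPhysics.QuantumManyBody.BoseGas.periodicGroundStateEnergy v (n + 1) L + δ → ∫⁻ X in Literature.MathematicalPhysics.QuantumManyBody.BoseGas.cellN (n + 1) L, ENNReal.ofReal (Literature.MathematicalPhysics.QuantumManyBody.BoseGas.jastrow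 L φ Finset.univ X ^ 2) * Literature.MathematicalPhysics.QuantumManyBody.BoseGas.kineticDensity (fun Z => Ψ.ψ Z / (Literature.MathematicalPhysics.QuantumManyBody.BoseGas.jastrow L φ Finset.univ Z : ℂ)) X ≤ ENNReal.ofReal (ε * ρ * ((n : ℝ) + 1))

/-- item stmt-AtomisticToContinuum-0827 · crux · rank 4 · open · by planner
why it might fail: PeriodicBEC(v) is ground-state-only (δ after N); the Dirichlet GS restricted to interior boxes is neither periodic nor of sharp N, so the hypothesis may never fire (transfer ≈ conjunct); BEC can be BC-sensitive (Robinson 1976).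
sources: LiebSeiringerSolovejYngvason2005 Ch. 2 after (2.8), Basti2022 = arXiv:2203.01841, BoccatoSeiringer2023 = arXiv:2205.15284, Junge2026 = arXiv:2603.20776, Robinson1976 = doi:10.1007/bf01608554, LauwersVerbeureZagrebnov2003 = arXiv:math-ph/0205037
[crux] BoundaryTransferWeak (mode-free boundary-condition transfer, per potential): for each
repulsive finite-range v, PeriodicBEC(v) implies ∃ρ₀>0 ∀ρ∈(0,ρ₀) HasGroundStateBEC v ρ (Dirichlet
ground state, λ_max(γ) ≥ cN via condensateNumber). Not glue: near-minimiser slacks are O(N/L²) while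
Dirichlet/periodic energies differ by a boundary term ≫ N/L², so no energy-comparison proof;
expected route: Neumann bracketing of interior sub-boxes (−Δ_Dir ≥ ⊕−Δ_Neu, v ≥ 0) + a mode-free
criterion (λ_max ≥ tr γ²/N). Only the ENERGY analogue is in print (LiebSeiringerSolovejYngvason2005
Ch. 2 after (2.8)). v ≡ 0: hypothesis and conclusion both true. -/
@[route_item "route-AtomisticToContinuum-BECParentAnchor", crux]
def BoundaryTransferWeak : Prop :=
  ∀ v : ℝ → ENNReal, Literature.MathematicalPhysics.QuantumManyBody.BoseGas.IsRepulsiveFiniteRange v → (∃ ρ₀ : ℝ, 0 < ρ₀ ∧ ∀ ρ : ℝ, 0 < ρ → ρ < ρ₀ → ∃ c : ℝ, 0 < c ∧ ∀ᶠ N : ℕ in Filter.atTop, ∃ δ : ENNReal, 0 < δ ∧ ∀ Ψ : Literature.MathematicalPhysics.QuantumManyBody.BoseGas.PeriodicTrialState N (Literature.MathematicalPhysics.QuantumManyBody.BoseGas.sideLength ρ N), Literature.MathematicalPhysics.QuantumManyBody.BoseGas.periodicEnergy v Ψ ≤ Literature.MathematicalPhysics.QuantumManyBody.BoseGas.periodicGroundStateEnergy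 v N (Literature.MathematicalPhysics.QuantumManyBody.BoseGas.sideLength ρ N) + δ → ENNReal.ofReal (c * N) ≤ Literature.MathematicalPhysics.QuantumManyBody.BoseGas.condensateOccupation N (Literature.MathematicalPhysics.QuantumManyBody.BoseGas.sideLength ρ N) Ψ.ψ) → ∃ ρ₀ : ℝ, 0 < ρ₀ ∧ ∀ ρ : ℝ, 0 < ρ → ρ < ρ₀ → Literature.MathematicalPhysics.QuantumManyBody.BoseGas.HasGroundStateBEC v ρ

/-- item stmt-AtomisticToContinuum-11262 · crux · rank 5 · open · by planner
why it might fail: a parent form ≤ ερN bounds Var(g) only via the N-body gap ~L⁻² (KineticGapLengthScales: void as L→∞); the real bet — g_Y a principal eigenfunction + integrable (t^{-3/2}, d=3) tagged-particle decorrelation, N-uniform — has no printed form and fails in d=1.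
sources: LiebSeiringerSolovejYngvason2005 Lemma 4.3 and Ch. 7 (7.5), KipnisVaradhan1986 = doi:10.1007/bf01210789, CalogeroMarchioro1973 = doi:10.1063/1.1666291, ReattoChester1967 = doi:10.1103/physrev.155.88, Literature.Barriers.AtomisticToContinuum.KineticGapLengthScales, Literature.Barriers.AtomisticToContinuum.OneDimensionalHardCore
[crux] the ANCHOR-TO-TRUTH TRANSFER — the route's mechanism made an item, and the wiring of
ParentEnergyProximity (dangling before rev 3): if near-minimisers of the periodic energy are
ε-approximate ground states of a Jastrow parent Hamiltonian (ParentEnergyProximity: ∫F²|∇(Ψ/F)|² ≤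
ερN for a positive pair profile), then their one-particle dressed correctors are flat in the
sharpened, pinned sense (PinnedCorrectorFlatness). Logically it is PinnedCorrectorFlatness with
ParentEnergyProximity available as a lemma — the glue of the one-child split PinnedCorrectorFlatness
⇐ ParentEnergyProximity; `closes` consumes FlatnessTransfer and ParentEnergyProximity (not
PinnedCorrectorFlatness), so both are load-bearing while the node stays claimable directly. Rank 5
only so that it renders after the decls it names; it is the XL bet of the line. Intended proof
(layer 2, not filed): RegularEnvironments (|Ψ|²-most Y have local counts ≤ Mρb³ in b-balls —
second-moment bounds of the parent-form type) + RegularFlatness (for regular Y, g_Y is the principal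
eigenfunction of −L_F + Q on L²(F²dX), L_F the F²-reversible dilute diffusion, Q = ε_wΣw − W₃
shallow; Feynman–Kac with a tagged-particle influence -/
@[route_item "route-AtomisticToContinuum-BECParentAnchor", crux]
def FlatnessTransfer : Prop :=
  ParentEnergyProximity → PinnedCorrectorFlatness

/-- item stmt-AtomisticToContinuum-11263 · support · rank 9 · open · by planner
sources: LiebSeiringerSolovejYngvason2005, Literature.MathematicalPhysics.QuantumManyBody.BoseGas.div_sideLength_pow_three
[support] bookkeeping glue PinnedCorrectorFlatness → PeriodicBEC (replaces FlatnessGivesPeriodicBEC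
stmt-9112; DressingBound is no longer a hypothesis but the lemma the proof goes through — prove/cite
the support DressingBound first): given v admissible, instantiate PinnedCorrectorFlatness at ε :=
1/2 to get ρ₀ and, per ρ, (b, K, η, J, φ) with ρJ(1+K) < 1, η < 1 and, eventually in n, flat-mass ≥
1−η for all δ-near-minimisers; for n large also 2b < L = ((n+1)/ρ)^{1/3} (tendsto_sideLength) and
nJ(1+K)/L³ = ρJ(1+K)·n/(n+1) < 1 (div_sideLength_pow_three), so DressingBound (support stmt-9110,
deterministic, audited true) applies and gives n₀ ≥ c(n+1) with c := (1−η)(1−√(ρJ(1+K)))²/(1+K) > 0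
((1−√t)² antitone on [0,1]; products in ℝ≥0∞ via ENNReal.ofReal_mul); shift N = n+1 in
Filter.eventually_atTop. The ε-conjuncts and the pins of the crux are simply not used. [difficulty:
provable-now] [deps: PinnedCorrectorFlatness, DressingBound, PeriodicBEC] -/
@[route_item "route-AtomisticToContinuum-BECParentAnchor", crux]
def PinnedFlatnessGivesPeriodicBEC : Prop :=
  PinnedCorrectorFlatness → PeriodicBEC

/-- item stmt-AtomisticToContinuum-9109 · support · rank 9 · open · by planner
sources: LiebSeiringerSolovejYngvason2005 Thm 2.2 proof (2.22)–(2.26), Mayers2001 = doi:10.1103/physrevb.64.224521, PenroseOnsager1956 §6, Griffin1993 p.188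
[support] the anchor condenses, deterministically: for every pair profile φ of cut-off b (0 < 2b <
L), every N and I ≥ ∫(1−φ²) with (N−1)I < L³, the normalised Jastrow product Π_{i<j}Φ(x_i−x_j)/‖·‖
on the torus of side L has constant-mode occupation ≥ (1 − (N−1)I/L³)²·N. Proof: n₀/N = ∫
L³|m(Y)|²dY with m = cell-mean of Ψ(·,Y); Π_jΦ(x−y_j) ≥ 1 − Σ_j(1−Φ(x−y_j)) (LSSY (2.24)–(2.25))
gives cell-mean ≥ 1 − (N−1)I/L³ while the cell-mean-square is ≤ 1. With LSSY2005_dysonProfile (I ≤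
16πab²): n₀/N ≥ 1/4 for b ≤ ξ/2, ξ = (8πρa)^{-1/2}. [difficulty: provable-now] -/
@[route_item "route-AtomisticToContinuum-BECParentAnchor"]
def JastrowAnchorBEC : Prop :=
  ∀ (N : ℕ) (L b I : ℝ) (φ : Literature.MathematicalPhysics.QuantumManyBody.BoseGas.Space → ℝ), Literature.MathematicalPhysics.QuantumManyBody.BoseGas.IsPairProfile b φ → 0 < L → 0 < b → 2 * b < L → 0 ≤ I → Literature.MathematicalPhysics.QuantumManyBody.BoseGas.profileDefect φ ≤ ENNReal.ofReal I → ((N : ℝ) - 1) * I < L ^ 3 → ENNReal.ofReal ((1 - ((N : ℝ) - 1) * I / L ^ 3) ^ 2 * N) ≤ Literature.MathematicalPhysics.QuantumManyBody.BoseGas.condensateOccupation N L (fun X => ((Literature.MathematicalPhysics.QuantumManyBody.BoseGas.jastrow L φ Finset.univ X / Real.sqrt (Literature.MathematicalPhysics.QuantumManyBody.BoseGas.jastrowNormR L φ (Finset.univ : Finset (Fin N))) : ℝ) : ℂ))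

/-- item stmt-AtomisticToContinuum-9110 · support · rank 9 · open · by planner
sources: Mayers2001 = doi:10.1103/physrevb.64.224521, LiebSeiringerSolovejYngvason2005 (2.24)–(2.25)
[support] deterministic dressing transfer at fixed N = n+1, L, positive profile φ (0 < 2b < L), K, J
≥ ∫(1−φ²) with nJ(1+K) < L³: for every periodic trial state Ψ, (n+1)(1−√(nJ(1+K)/L³))²/(1+K) ×
[|Ψ|²-mass of the environments Y ∈ cell^n whose dressed corrector g_Y = Ψ(·,Y)/Π_jΦ(·−y_j) satisfies
L³∫_cell|g_Y|² ≤ (1+K)|∫_cell g_Y|²] ≤ n₀(Ψ). Proof: |∫Dg| ≥ |∫g| − √(∫(1−D))·√(∫|g|²), ∫_cell(1−D)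
≤ nJ, and ∫|Dg|² ≤ ∫|g|²; then n₀ = (n+1)∫L³|m|² ≥ c₀(n+1)∫_flat L³ s. [difficulty: provable-now] -/
@[route_item "route-AtomisticToContinuum-BECParentAnchor"]
def DressingBound : Prop :=
  ∀ (n : ℕ) (L b K J : ℝ) (φ : Literature.MathematicalPhysics.QuantumManyBody.BoseGas.Space → ℝ) (Ψ : Literature.MathematicalPhysics.QuantumManyBody.BoseGas.PeriodicTrialState (n + 1) L), Literature.MathematicalPhysics.QuantumManyBody.BoseGas.IsPairProfile b φ → (∀ x, 0 < φ x) → 0 < L → 0 < b → 2 * b < L → 0 ≤ K → 0 ≤ J → Literature.MathematicalPhysics.QuantumManyBody.BoseGas.profileDefect φ ≤ ENNReal.ofReal J → (n : ℝ) * J * (1 + K) < L ^ 3 → ENNReal.ofReal (((n : ℝ) + 1) * (1 - Real.sqrt ((n : ℝ) * J * (1 + K) / L ^ 3)) ^ 2 / (1 + K)) * (∫⁻ Y in {Y : Literature.MathematicalPhysics.QuantumManyBody.BoseGas.Config n | Y ∈ Literature.MathematicalPhysics.QuantumManyBody.BoseGas.cellN n L ∧ ENNReal.ofReal (L ^ 3)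 * (∫⁻ x in Literature.MathematicalPhysics.QuantumManyBody.BoseGas.cell L, (‖Ψ.ψ (Matrix.vecCons x Y) / ∏ j, (Literature.MathematicalPhysics.QuantumManyBody.BoseGas.pairFactor L φ (x - Y j) : ℂ)‖₊ : ENNReal) ^ 2) ≤ ENNReal.ofReal (1 + K) * (‖∫ x in Literature.MathematicalPhysics.QuantumManyBody.BoseGas.cell L, Ψ.ψ (Matrix.vecCons x Y) / ∏ j, (Literature.MathematicalPhysics.QuantumManyBody.BoseGas.pairFactor L φ (x - Y j) : ℂ)‖₊ : ENNReal) ^ 2}, ∫⁻ x in Literature.MathematicalPhysics.QuantumManyBody.BoseGas.cell L, (‖Ψ.ψ (Matrix.vecCons x Y)‖₊ : ENNReal) ^ 2) ≤ Literature.MathematicalPhysics.QuantumManyBody.BoseGas.condensateOccupation (n + 1) L Ψ.ψ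

/-- item stmt-AtomisticToContinuum-9111 · support · rank 9 · open · by planner
sources: CalogeroMarchioro1973 = doi:10.1063/1.1666291, LiebSeiringerSolovejYngvason2005 Lemma 4.1 (in tree: LSSY2005_lemma41_periodic, neumannPoincare_boxN), ReedSimonIV1978 XIII.12
[support] the card's theorem-candidate (A) in near-minimiser form: for every positive pair profile φ
(cut-off b), J ≥ ∫(1−φ²) and density with 2ρJ ≤ 1, for all large N = n+1 there is δ > 0 such that
every periodic trial state Ψ whose parent form ∫_{cell^N}F²|∇(Ψ/F)|² is ≤ δ (i.e. every
δ-near-minimiser of the parent Hamiltonian H_F = −Δ + ΔF/F ≥ 0, whose ground state is the Jastrow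
state F) has constant-mode occupation ≥ N/8 on the torus of side (N/ρ)^{1/3}. Proof: weighted
Poincaré on the torus at fixed N (F² ∈ [θ^{N(N−1)},1]) ⇒ Ψ ≈ cF in L²; √(n₀/N) is 1-Lipschitz in Ψ;
JastrowAnchorBEC. [difficulty: M] -/
@[route_item "route-AtomisticToContinuum-BECParentAnchor"]
def ParentHamiltonianBEC : Prop :=
  ∀ (b J : ℝ) (φ : Literature.MathematicalPhysics.QuantumManyBody.BoseGas.Space → ℝ), Literature.MathematicalPhysics.QuantumManyBody.BoseGas.IsPairProfile b φ → (∀ x, 0 < φ x) → 0 < b → 0 ≤ J → Literature.MathematicalPhysics.QuantumManyBody.BoseGas.profileDefect φ ≤ ENNReal.ofReal J → ∀ ρ : ℝ, 0 < ρ → 2 * ρ * J ≤ 1 → ∀ᶠ n : ℕ in Filter.atTop, let L : ℝ := Literature.MathematicalPhysics.QuantumManyBody.BoseGas.sideLength ρ (n + 1); ∃ δ : ENNReal, 0 < δ ∧ ∀ Ψ : Literature.MathematicalPhysics.QuantumManyBody.BoseGas.PeriodicTrialState (n + 1) L, (∫⁻ X in Literature.MathematicalPhysics.QuantumManyBody.BoseGas.cellN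 (n + 1) L, ENNReal.ofReal (Literature.MathematicalPhysics.QuantumManyBody.BoseGas.jastrow L φ Finset.univ X ^ 2) * Literature.MathematicalPhysics.QuantumManyBody.BoseGas.kineticDensity (fun Z => Ψ.ψ Z / (Literature.MathematicalPhysics.QuantumManyBody.BoseGas.jastrow L φ Finset.univ Z : ℂ)) X) ≤ δ → ENNReal.ofReal (((n : ℝ) + 1) / 8) ≤ Literature.MathematicalPhysics.QuantumManyBody.BoseGas.condensateOccupation (n + 1) L Ψ.ψ

-- earlier Assembly (stmt-AtomisticToContinuum-9113, replaced 2026-08-15T16:55:57Z -> stmt-AtomisticToContinuum-11260): retired by None — CorrectorFlatness → DressingBound → FlatnessGivesPeriodicBEC → BoundaryTransferWeak → _root_.BoseEinsteinCondensation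
/-- item stmt-AtomisticToContinuum-11260 · assembly · rank 1 · open · by planner
sources: LiebSeiringerSolovejYngvason2005
[assembly] ParentEnergyProximity → FlatnessTransfer → PinnedFlatnessGivesPeriodicBEC →
BoundaryTransferWeak → BoseEinsteinCondensation (the sub-problem decl
`_root_.BoseEinsteinCondensation`); literally the type of the rev-3 deciding theorem `closes`
(DressingBound enters through the proof of PinnedFlatnessGivesPeriodicBEC). -/
@[route_item "route-AtomisticToContinuum-BECParentAnchor"]
def Assembly : Prop :=
  ParentEnergyProximity → FlatnessTransfer → PinnedFlatnessGivesPeriodicBEC → BoundaryTransferWeak → _root_.BoseEinsteinCondensation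

/-! D-0027 §2.1 — DECIDING THEOREM (planner-authored via `route open/edit --closes-file`; by planner-rrepair-AtomisticToContinuum-BECParent-b31733a0-g2-0 2026-08-15T16:55:57Z):
its hypotheses are this route's items and its conclusion the sub-problem Statement (glue_lint), and it elaborates with this file. -/

@[closes "route-AtomisticToContinuum-BECParentAnchor"] theorem closes (h₁ : ParentEnergyProximity) (h₂ : FlatnessTransfer) (h₃ : PinnedFlatnessGivesPeriodicBEC) (h₄ : BoundaryTransferWeak) : _root_.BoseEinsteinCondensation :=
  fun v hv => h₄ v hv (h₃ (h₂ h₁) v hv)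

end Summit.AtomisticToContinuum.BoseEinsteinCondensation.Theses.BECParentAnchor
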